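import Mathlib
import HarnessLib

/-!
# d'Alembert's solution of the free 1+1 wave equation from `C² × C¹` Cauchy data

Analysis/PDE support file (everything proved, no definitions). For data `h ∈ C²(ℝ)`, `g ∈ C¹(ℝ)`
the function `φ₀(t, x) = F(x − t) + G(x + t)` with `F = (h − Ig)/2`, `G = (h + Ig)/2`,
`Ig(x) = ∫_0^x g`, is a `C²` solution of `φ_tt = φ_xx` with `φ₀(0,·) = h`, `∂_t φ₀(0,·) = g`
(d'Alembert 1747). `exists_dAlembert_solution` packages this in the curried one-variable language of
the tree's 1+1 wave items (`deriv`, `iteratedDeriv 2`), together with the facts the channel-of-energy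
arguments use:

* the travelling-wave profiles: `F + G = h`, `G' − F' = g`, `F' + G' = h'`, so `2F'² + 2G'² = h'² + g²`;
* the energy density splits into a right-mover and a left-mover:
  `(∂_t φ₀)² + (∂_x φ₀)² = 2F'(x − t)² + 2G'(x + t)²`,
  whence the exact two-sided exterior channel identity of the free equation (the `V ≡ 0`,
  `c = 1` case of the Regge–Wheeler channel items of route PhotonSphereChannels): energy to the left
  of `a − |t|` is `≥ 2∫_{y<a} G'²` for `t ≥ 0` and `≥ 2∫_{y<a} F'²` for `t ≤ 0`
  (`dAlembert_intervalEnergy_ge_right/left`, interval form).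

Mathlib: FTC (`intervalIntegral.integral_hasDerivAt_right`), `contDiff_succ_iff_deriv`; no packaged
d'Alembert formula. Reference: L. C. Evans, *Partial Differential Equations*, 2nd ed., §2.4.1.
Folklore.
-/

noncomputable section

namespace Literature.Analysis.PDE

open MeasureTheory Set Filter Topology intervalIntegral

/-- A primitive of a `C¹` function is `C²`: `x ↦ ∫_0^x g` is `C²` with derivative `g`. [folklore] -/
theorem contDiff_two_primitive {g : ℝ → ℝ} (hg : ContDiff ℝ 1 g) :
    ContDiff ℝ 2 (fun x => ∫ y in (0 : ℝ)..x, g y) ∧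
      ∀ x, HasDerivAt (fun x => ∫ y in (0 : ℝ)..x, g y) (g x) x := by
  have hgc : Continuous g := hg.continuous
  have hd : ∀ x, HasDerivAt (fun x => ∫ y in (0 : ℝ)..x, g y) (g x) x := fun x =>
    intervalIntegral.integral_hasDerivAt_right (hgc.intervalIntegrable _ _)
      (hgc.stronglyMeasurableAtFilter _ _) hgc.continuousAt
  refine ⟨?_, hd⟩
  rw [show (2 : WithTop ℕ∞) = (1 : WithTop ℕ∞) + 1 by norm_num, contDiff_succ_iff_deriv]
  refine ⟨fun x => (hd x).differentiableAt, fun h => absurd h (by simp), ?_⟩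
  have : deriv (fun x => ∫ y in (0 : ℝ)..x, g y) = g := funext fun x => (hd x).deriv
  rw [this]
  exact hg

/-- **d'Alembert's solution, packaged.** For `h ∈ C²`, `g ∈ C¹` there are `C²` profiles `F, G` and the
`C²` function `φ₀(t,x) = F(x − t) + G(x + t)` such that: `F + G = h`, `G' − F' = g`, `F' + G' = h'`;
`φ₀` solves the free wave equation `∂_t² φ₀ = ∂_x² φ₀` (with `iteratedDeriv 2` in each variable) with
Cauchy data `(h, g)` at `t = 0`; its first partials are `∂_t φ₀ = −F'(x−t) + G'(x+t)`,
`∂_x φ₀ = F'(x−t) + G'(x+t)`, so the free energy density is `2F'(x−t)² + 2G'(x+t)²`, and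
`2F'² + 2G'² = h'² + g²`. [folklore] -/
theorem exists_dAlembert_solution {h g : ℝ → ℝ} (hh : ContDiff ℝ 2 h) (hg : ContDiff ℝ 1 g) :
    ∃ (φ₀ : ℝ → ℝ → ℝ) (F G : ℝ → ℝ),
      ContDiff ℝ 2 (Function.uncurry φ₀) ∧ ContDiff ℝ 2 F ∧ ContDiff ℝ 2 G ∧
      (∀ t x, φ₀ t x = F (x - t) + G (x + t)) ∧
      (∀ x, F x + G x = h x) ∧ (∀ x, deriv G x - deriv F x = g x) ∧
      (∀ x, deriv F x + deriv G x = deriv h x) ∧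
      (∀ x, 2 * deriv F x ^ 2 + 2 * deriv G x ^ 2 = deriv h x ^ 2 + g x ^ 2) ∧
      (∀ t x, iteratedDeriv 2 (fun τ => φ₀ τ x) t = iteratedDeriv 2 (φ₀ t) x) ∧
      (∀ x, φ₀ 0 x = h x) ∧ (∀ x, deriv (fun τ => φ₀ τ x) 0 = g x) ∧
      (∀ t x, deriv (fun τ => φ₀ τ x) t = -deriv F (x - t) + deriv G (x + t)) ∧
      (∀ t x, deriv (φ₀ t) x = deriv F (x - t) + deriv G (x + t)) ∧
      (∀ t x, deriv (fun τ => φ₀ τ x) t ^ 2 + deriv (φ₀ t) x ^ 2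
          = 2 * deriv F (x - t) ^ 2 + 2 * deriv G (x + t) ^ 2) := by
  obtain ⟨hIg, hIg'⟩ := contDiff_two_primitive hg
  set Ig : ℝ → ℝ := fun x => ∫ y in (0 : ℝ)..x, g y with hIg_def
  set F : ℝ → ℝ := fun x => (h x - Ig x) / 2 with hF_def
  set G : ℝ → ℝ := fun x => (h x + Ig x) / 2 with hG_def
  have hFc : ContDiff ℝ 2 F := (hh.sub hIg).div_const 2
  have hGc : ContDiff ℝ 2 G := (hh.add hIg).div_const 2
  have h2 : (2 : WithTop ℕ∞) ≠ 0 := by norm_num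
  have hhd : Differentiable ℝ h := hh.differentiable h2
  -- first derivatives of the profiles
  have hF' : ∀ x, HasDerivAt F ((deriv h x - g x) / 2) x := fun x =>
    ((hhd x).hasDerivAt.sub (hIg' x)).div_const 2
  have hG' : ∀ x, HasDerivAt G ((deriv h x + g x) / 2) x := fun x =>
    ((hhd x).hasDerivAt.add (hIg' x)).div_const 2
  have hdF : ∀ x, deriv F x = (deriv h x - g x) / 2 := fun x => (hF' x).deriv
  have hdG : ∀ x, deriv G x = (deriv h x + g x) / 2 := fun x => (hG' x).deriv
  -- second derivatives of the profiles
  have hderiv1 : ∀ {Φ : ℝ → ℝ}, ContDiff ℝ 2 Φ → ContDiff ℝ 1 (deriv Φ) := by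
    intro Φ hΦ
    have h' : ContDiff ℝ ((1 : WithTop ℕ∞) + 1) Φ := by
      rw [show ((1 : WithTop ℕ∞) + 1) = 2 by norm_num]; exact hΦ
    exact (contDiff_succ_iff_deriv.1 h').2.2
  have hFd : Differentiable ℝ F := hFc.differentiable h2
  have hGd : Differentiable ℝ G := hGc.differentiable h2
  have hF'd : Differentiable ℝ (deriv F) := (hderiv1 hFc).differentiable (by norm_num)
  have hG'd : Differentiable ℝ (deriv G) := (hderiv1 hGc).differentiable (by norm_num)
  -- the solution
  set φ₀ : ℝ → ℝ → ℝ := fun t x => F (x - t) + G (x + t) with hφ₀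
  -- chain rules
  have cτ1 : ∀ {Φ : ℝ → ℝ}, Differentiable ℝ Φ → ∀ t x,
      HasDerivAt (fun τ => Φ (x - τ)) (-deriv Φ (x - t)) t := by
    intro Φ hΦ t x
    have := ((hΦ (x - t)).hasDerivAt).comp t ((hasDerivAt_const t x).sub (hasDerivAt_id t))
    simpa [Function.comp_def] using this
  have cτ2 : ∀ {Φ : ℝ → ℝ}, Differentiable ℝ Φ → ∀ t x,
      HasDerivAt (fun τ => Φ (x + τ)) (deriv Φ (x + t)) t := by
    intro Φ hΦ t x
    have := ((hΦ (x + t)).hasDerivAt).comp t ((hasDerivAt_const t x).add (hasDerivAt_id t))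
    simpa [Function.comp_def] using this
  have cx1 : ∀ {Φ : ℝ → ℝ}, Differentiable ℝ Φ → ∀ t x,
      HasDerivAt (fun y => Φ (y - t)) (deriv Φ (x - t)) x := by
    intro Φ hΦ t x
    have := ((hΦ (x - t)).hasDerivAt).comp x ((hasDerivAt_id x).sub (hasDerivAt_const x t))
    simpa [Function.comp_def] using this
  have cx2 : ∀ {Φ : ℝ → ℝ}, Differentiable ℝ Φ → ∀ t x,
      HasDerivAt (fun y => Φ (y + t)) (deriv Φ (x + t)) x := by
    intro Φ hΦ t x
    have := ((hΦ (x + t)).hasDerivAt).comp x ((hasDerivAt_id x).add (hasDerivAt_const x t))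
    simpa [Function.comp_def] using this
  -- first partials of `φ₀`
  have hτ : ∀ t x, HasDerivAt (fun τ => φ₀ τ x) (-deriv F (x - t) + deriv G (x + t)) t :=
    fun t x => (cτ1 hFd t x).add (cτ2 hGd t x)
  have hx : ∀ t x, HasDerivAt (φ₀ t) (deriv F (x - t) + deriv G (x + t)) x :=
    fun t x => (cx1 hFd t x).add (cx2 hGd t x)
  -- second partials of `φ₀`
  have hττ : ∀ t x, iteratedDeriv 2 (fun τ => φ₀ τ x) t
      = deriv (deriv F) (x - t) + deriv (deriv G) (x + t) := by
    intro t x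
    rw [iteratedDeriv_succ, iteratedDeriv_one]
    have e1 : deriv (fun τ => φ₀ τ x) = fun τ => -deriv F (x - τ) + deriv G (x + τ) :=
      funext fun τ => (hτ τ x).deriv
    rw [e1]
    have h' : HasDerivAt (fun τ => -deriv F (x - τ) + deriv G (x + τ))
        (-(-deriv (deriv F) (x - t)) + deriv (deriv G) (x + t)) t :=
      ((cτ1 hF'd t x).neg).add (cτ2 hG'd t x)
    rw [h'.deriv]
    ring
  have hxx : ∀ t x, iteratedDeriv 2 (φ₀ t) x
      = deriv (deriv F) (x - t) + deriv (deriv G) (x + t) := by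
    intro t x
    rw [iteratedDeriv_succ, iteratedDeriv_one]
    have e1 : deriv (φ₀ t) = fun y => deriv F (y - t) + deriv G (y + t) :=
      funext fun y => (hx t y).deriv
    rw [e1]
    exact ((cx1 hF'd t x).add (cx2 hG'd t x)).deriv
  refine ⟨φ₀, F, G, ?_, hFc, hGc, fun t x => rfl, ?_, ?_, ?_, ?_, ?_, ?_, ?_, ?_, ?_, ?_⟩
  · -- `C²`
    show ContDiff ℝ 2 fun p : ℝ × ℝ => F (p.2 - p.1) + G (p.2 + p.1)
    exact (hFc.comp (contDiff_snd.sub contDiff_fst)).add (hGc.comp (contDiff_snd.add contDiff_fst))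
  · intro x; simp only [hF_def, hG_def]; ring
  · intro x; rw [hdF, hdG]; ring
  · intro x; rw [hdF, hdG]; ring
  · intro x; rw [hdF, hdG]; ring
  · intro t x; rw [hττ, hxx]
  · intro x
    simp only [hφ₀, sub_zero, add_zero, hF_def, hG_def]
    ring
  · intro x
    rw [(hτ 0 x).deriv, sub_zero, add_zero, hdF, hdG]
    ring
  · intro t x; exact (hτ t x).deriv
  · intro t x; exact (hx t x).deriv
  · intro t x
    rw [(hτ t x).deriv, (hx t x).deriv]
    ring

/-- **Free right-channel lower bound, interval form.** With `φ₀, F, G` as in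
`exists_dAlembert_solution`: on any interval, the free energy at time `t` dominates the left-mover:
`∫_u^v ((∂_t φ₀)² + (∂_x φ₀)²)(t,·) ≥ 2∫_{u+t}^{v+t} G'²` (`u ≤ v`). [folklore] -/
theorem dAlembert_intervalEnergy_ge_left_mover {φ₀ : ℝ → ℝ → ℝ} {F G : ℝ → ℝ}
    (hG : ContDiff ℝ 2 G) (hF : ContDiff ℝ 2 F)
    (he : ∀ t x, deriv (fun τ => φ₀ τ x) t ^ 2 + deriv (φ₀ t) x ^ 2
      = 2 * deriv F (x - t) ^ 2 + 2 * deriv G (x + t) ^ 2)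
    (t : ℝ) {u v : ℝ} (huv : u ≤ v) :
    2 * ∫ y in (u + t)..(v + t), deriv G y ^ 2
      ≤ ∫ x in u..v, (deriv (fun τ => φ₀ τ x) t ^ 2 + deriv (φ₀ t) x ^ 2) := by
  have hGc : Continuous (deriv G) := hG.continuous_deriv (by norm_num)
  have hFc : Continuous (deriv F) := hF.continuous_deriv (by norm_num)
  simp only [he]
  rw [← intervalIntegral.integral_comp_add_right (fun y => deriv G y ^ 2) t,
    ← intervalIntegral.integral_const_mul]
  refine intervalIntegral.integral_mono_on huv ?_ ?_ fun x _ => ?_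
  · exact (((hGc.comp (continuous_id.add continuous_const)).pow 2).const_mul 2).intervalIntegrable _ _
  · exact ((((hFc.comp (continuous_id.sub continuous_const)).pow 2).const_mul 2).add
      (((hGc.comp (continuous_id.add continuous_const)).pow 2).const_mul 2)).intervalIntegrable _ _
  · have : 0 ≤ 2 * deriv F (x - t) ^ 2 := by positivity
    simpa using this

/-- **Free left-channel lower bound, interval form**: `∫_u^v ((∂_t φ₀)² + (∂_x φ₀)²)(t,·) ≥ 2∫_{u−t}^{v−t} F'²`
(`u ≤ v`). [folklore] -/
theorem dAlembert_intervalEnergy_ge_right_mover {φ₀ : ℝ → ℝ → ℝ} {F G : ℝ → ℝ}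
    (hG : ContDiff ℝ 2 G) (hF : ContDiff ℝ 2 F)
    (he : ∀ t x, deriv (fun τ => φ₀ τ x) t ^ 2 + deriv (φ₀ t) x ^ 2
      = 2 * deriv F (x - t) ^ 2 + 2 * deriv G (x + t) ^ 2)
    (t : ℝ) {u v : ℝ} (huv : u ≤ v) :
    2 * ∫ y in (u - t)..(v - t), deriv F y ^ 2
      ≤ ∫ x in u..v, (deriv (fun τ => φ₀ τ x) t ^ 2 + deriv (φ₀ t) x ^ 2) := by
  have hGc : Continuous (deriv G) := hG.continuous_deriv (by norm_num)
  have hFc : Continuous (deriv F) := hF.continuous_deriv (by norm_num)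
  simp only [he]
  rw [← intervalIntegral.integral_comp_sub_right (fun y => deriv F y ^ 2) t,
    ← intervalIntegral.integral_const_mul]
  refine intervalIntegral.integral_mono_on huv ?_ ?_ fun x _ => ?_
  · exact (((hFc.comp (continuous_id.sub continuous_const)).pow 2).const_mul 2).intervalIntegrable _ _
  · exact ((((hFc.comp (continuous_id.sub continuous_const)).pow 2).const_mul 2).add
      (((hGc.comp (continuous_id.add continuous_const)).pow 2).const_mul 2)).intervalIntegrable _ _
  · have : 0 ≤ 2 * deriv G (x + t) ^ 2 := by positivity
    simpa using this

end Literature.Analysis.PDE
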